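import Summits.QuantumFields.BalabanUV.Beta.GAN24.CombForcingWordsLevelZero
import Summits.QuantumFields.BalabanUV.Beta.GAN24.CombChargeAntisymPairForm

/-!
# `BalabanUV.Beta.GAN24.CombForcingPairFormLevelZero` — binder row G-an2-4 ∕ (CONV-C), TRANSFER-III, the (III′) (C)-campaign: **THE OWNER's SUPPLIER `hB0` AT LEVEL `0` AT THE COMB DATA,
# AND THE CROSSED CELL VALUE `X(zmode_Lc b̃′_0)(a,b) = −2·Lc¹²·(Lc² − 1)`** — leaf-04 g68's `RespWordsLevelZero.zmode_dressedSource_level0_closed` and leaf-06 g55's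
# `ForcingCellPairFormLevelZero` VERBATIM at the comb tokens (`GcombSh`, `SpureCombOf (symTablesAn1S2 d Lc cΛt)`, the sym tables, `hB0`'s border `vh₂S`), by F2's 21, leaf-04's 21
# `zmode_dressedSource_inl_inl_of_summable` at `r := ctrOff (d+1) Lc`, F `CombForcingWordsLevelZero` (the two exchange words = the two `S^E ⊗ S^E` numbers) and F5 (`K·W·K = 0`)
# (G-an2-4 CRUX TEAM (2), leaf prover `b2b-balaban-gan24-formalise-leaf-01`, gen 86; journal [LEAF01-G86-INTENT-6]; OWNER gan24-p1 g52's (α)(β), journal l.67522)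

NOT IN PRINT; OUR BOOKKEEPING ([folklore] one `rw` chain BY NAME + leaf-06 g55's finite index algebra (`CombChargeAntisymPairForm.pairFormLS_of_pairForm`); 0 `def`, 0 cited fact, 0 `def … : Prop`,
0 sorry).  HONEST FRAMING (cell contract, verbatim): «discharging `BetaPertH` makes Bałaban's UV stability UNCONDITIONAL — a real constructive-QFT result; it is NOT the continuum limit and
NOT the Clay problem.»  HONEST DEPENDENCY (verbatim): «continuum YM on T⁴ ⇐ BetaPertH ∧ nine spine estimates (0/9 proved); BetaPertH ⇐ (D1) ∧ (D4) ∧ CAP+tail; G-an2-4 gates asym, D1 and NE2/3/4.»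

WHAT ([folklore]; `[NeZero Lc]`, an1's record `symTablesAn1S2 d Lc cΛt`, LEVEL `0`, all units `s_f s_m`, colour constants `cE cVH cΛ`, scalars `c cB`, ANY border `B` without ff block).  With
`b̃′_0 := c • mmRead Lc (K3OfK (unitK s_f s_m (GcombSh Lc 0)) Lc (unitS s_f s_m (SpureCombOf tabs cE cVH cΛ 0)) (unitM s_f s_m (tabs.M 0)) W̃′_0) + cB • B` (F2's letters), `σ₀ = (Lc^{0+1})^{−(d+2)}`,
`K₁ = (Lc·s_m s_f·σ₀)·((s_f s_m)⁻¹ s_f⁻² cE)`, `E = [μ=ν][α=β] − [μ=β][α=ν]`, `E′ = [ν=μ][α=β] − [ν=β][α=μ]`, `C₀ = c·(−(s_f s_m σ₀)²Lc²)·(−K₁²s_f²·½Lc^{d−1}(Lc^{d+1} − Lc^{d−1}))`: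
* §1 **`zmode_combForcing_level0_closed`** (generic `d`): `zmode Lc b̃′_0 (μ,ν; inl α, inl β) = c·(−(s_f s_m σ₀)²Lc²)·(−K₁²s_f²E·½… + −K₁²s_f²E′·½…)` — leaf-04's closed form, the comb tokens inside;
* §2 **`zmode_combForcing_level0_eq_pairForm`**, **`pairFormLS_combForcing_level0`** (generic `d`): the entrywise pair form `C₀·P(κκ₁;κ′κ₂) + C₀·P(κ′κ₁;κκ₂)` and road-P2 F9's `LS` pair form
  (witness `T = 2·C₀·P`); **`pairFormLS_combForcing_level0_lit`** (`d = 3`, units `sfStep Lc 0 ∕ smStep 3 Lc 0`, `c = cE₂·Lc^{2(3+1)}`, border `(symTablesAn1S2 3 Lc cΛt).vh₂S`) = the OWNER's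
  binder `hB0` of `CombChartChargeTowerPairFormClosed` AT `i = 0`, nothing renamed;
* §3 **`crossed_zmode_combForcing_level0`** (`a ≠ b`: `X = −4·C₀`) and **`crossed_zmode_combForcing_level0_pin`** (`d = 3`, pins `cE = Lc^4`, `cE₂ = Lc^8`: `X(zmode_Lc b̃′_0)(a,b) = −2·Lc¹²·(Lc²−1)`)
  — the OWNER's question (β) answered YES at level `0`.
WHAT THIS IS NOT: `hB0 i` for `i ≥ 1` is NOT here (levels `≥ 1` stay behind (D)_comb ∕ (Z)_comb, leaf-01 g86 C `CombVHEWordsZeroStep`); nothing of `hBF` ∕ `hX` ∕ `hstep` ∕ (Q-L) ∕ (hW, hWall);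
NEVER «G-an2-4 closed» as (CONV-C); NOT D1, NOT `BetaPertH`, NOT continuum, NOT Clay.  2026-08-27; no existing file touched.
-/

noncomputable section

open Finset
open scoped BigOperators
open Literature.MathematicalPhysics.QuantumFieldTheory
open Literature.MathematicalPhysics.QuantumFieldTheory.Balaban1983to89
open Literature.MathematicalPhysics.QuantumFieldTheory.Balaban1983to89.Beta
open ExpKernelCalculus (Site MKer comp shiftK Decays BiLoc VertexFamily)
open OneStepResolventKernel (Fib LocStencil decays_mono biLoc_mono)
open OneStepKernelFamily (KInvStep)
open SecondOrderResponse (dM W2SymOfK vertexFamily_dM)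
open BalabanStepJetsSucc (mmRead)
open BalabanStepW2 (K3OfK M2Of)
open AffineAveraging (box toSite)
open AveragingContoursRooted (ctr ctrOff ctrOff_mem_box)
open Summit.QuantumFields.BalabanUV.Beta.TameKernelCalculus (trK Loc Spr)
open Summit.QuantumFields.BalabanUV.Beta.AxialDressingRooted (coDressKBmAt)
open Summit.QuantumFields.BalabanUV.Beta.HessKerDressedUnits (unitK unitS)
open Summit.QuantumFields.BalabanUV.Beta.SecondOrderUnits (unitM unitM₂)
open Summit.QuantumFields.BalabanUV.Beta.SymSecondOrderTablesAn1 (symTablesAn1S2)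
open Summit.QuantumFields.BalabanUV.Beta.CombChartStepJets (GcombSh SpureCombOf)
open Summit.QuantumFields.BalabanUV.Beta.SymCorrectorKernel (psiKS)
open Summit.QuantumFields.BalabanUV.Beta.SymCorrectorFace (slotPsiS)
open Summit.QuantumFields.BalabanUV.Beta.GAN24.BiStencilZeroMode (Tab zmode)
open Summit.QuantumFields.BalabanUV.Beta.GAN24.CombesThomas (sfStep smStep)
open Summit.QuantumFields.BalabanUV.Beta.GAN24.CombTransportedBorder (pos_Lc)
open Summit.QuantumFields.BalabanUV.Beta.GAN24.CombForcingTwoFaceWords (spr_unitK_bm exists_locStencil_transport_S exists_vertexFamily_transport_M exists_locStencilFM_transport_M₂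
  loc_dM_bm_transport loc_W2SymOfK_bm_transport)
open Summit.QuantumFields.BalabanUV.Beta.GAN24.CombForcingTransport (zmode_combForcing_eq_bm_transport)
open Summit.QuantumFields.BalabanUV.Beta.GAN24.CombWWordZero (transportM₂_translate sum_box_tsum_W_word_an1_eq_zero)
open Summit.QuantumFields.BalabanUV.Beta.GAN24.DressedSourceZeroModeWords (zmode_dressedSource_inl_inl_of_summable)
open Summit.QuantumFields.BalabanUV.Beta.GAN24.DressedSourceExchangeWords (summable_right_word summable_left_word)
open Summit.QuantumFields.BalabanUV.Beta.GAN24.WWordRespSummable (summable_twoFace_W2SymOfK_dressedStep_bond)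
open Summit.QuantumFields.BalabanUV.Beta.GAN24.ExchangeSlotResum (face_weight_periodic)
open Summit.QuantumFields.BalabanUV.Beta.GAN24.CombChargeAntisymPairForm (pairFormLS_of_pairForm)
open Summit.QuantumFields.BalabanUV.Beta.GAN24.CombForcingWordsLevelZero (sum_box_comb_direct_word_level0_eq sum_box_comb_swap_word_level0_eq)

namespace Summit.QuantumFields.BalabanUV.Beta.GAN24.CombForcingPairFormLevelZero

variable {d : ℕ} {Lc : ℕ} [NeZero Lc]

/-! ## §1 The ff zero mode of the comb forcing at level 0 in closed form -/

/-- NOT IN PRINT; OUR BOOKKEEPING ([folklore]; leaf-04's `RespWordsLevelZero.zmode_dressedSource_level0_closed` AT THE COMB DATA).  **THE ff ZERO MODE OF THE COMB CHART's E-FRAME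
FORCING AT LEVEL `0` IS THE TWO `S^E ⊗ S^E` NUMBERS** (an1's record, all units, `cE cVH cΛ c cB`, ANY border `B` without ff block, every axis pattern): F2's
`zmode_combForcing_eq_bm_transport` ⨾ leaf-04's 21 `zmode_dressedSource_inl_inl_of_summable` at `r := ctrOff (d+1) Lc` (summability: 30 `summable_right_word ∕ summable_left_word`, 32
`summable_twoFace_W2SymOfK_dressedStep_bond`, F2 ∕ F5's sockets) ⨾ F `sum_box_comb_direct_word_level0_eq ∕ sum_box_comb_swap_word_level0_eq` ⨾ F5 `sum_box_tsum_W_word_an1_eq_zero`. -/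
theorem zmode_combForcing_level0_closed (cΛt sf sm cE cVH cΛ c cB : ℝ) {B : Tab d}
    (hBff : ∀ κ u κ' u' x z (α β : Fin (d + 1)), B κ u κ' u' x z (Sum.inl α) (Sum.inl β) = 0) (μ ν α β : Fin (d + 1)) :
    zmode Lc (fun κ u κ' u' => c • mmRead Lc (K3OfK (unitK sf sm (GcombSh (d := d) Lc 0)) Lc (unitS sf sm (SpureCombOf (symTablesAn1S2 d Lc cΛt) cE cVH cΛ 0))
        (unitM sf sm ((symTablesAn1S2 d Lc cΛt).M 0))
        (W2SymOfK (unitK sf sm (GcombSh (d := d) Lc 0)) Lc (unitS sf sm (SpureCombOf (symTablesAn1S2 d Lc cΛt) cE cVH cΛ 0)) (unitM sf sm ((symTablesAn1S2 d Lc cΛt).M 0)) 0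
          (unitM₂ sf sm (M2Of d Lc (symTablesAn1S2 d Lc cΛt).mixFF 0))) κ u κ' u') + cB • B κ u κ' u') μ ν (Sum.inl α) (Sum.inl β)
      = c * (-((sf * sm * ((((Lc ^ (0 + 1) : ℕ) : ℝ)) ^ (d + 1 + 1))⁻¹) * (sf * sm * ((((Lc ^ (0 + 1) : ℕ) : ℝ)) ^ (d + 1 + 1))⁻¹)) * ((Lc : ℝ) * (Lc : ℝ))) *
        (-(((((Lc : ℝ) * (sm * sf)) * ((((Lc ^ (0 + 1) : ℕ) : ℝ)) ^ (d + 1 + 1))⁻¹) * ((sf * sm)⁻¹ * (sf⁻¹ * sf⁻¹) * cE))) ^ 2 * (sf * sf) *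
            (((if μ = ν ∧ α = β then (1 : ℝ) else 0) - (if μ = β ∧ α = ν then (1 : ℝ) else 0)) * ((1 / 2 : ℝ) * (Lc : ℝ) ^ (d - 1) * ((Lc : ℝ) ^ (d + 1) - (Lc : ℝ) ^ (d - 1)))) +
          -(((((Lc : ℝ) * (sm * sf)) * ((((Lc ^ (0 + 1) : ℕ) : ℝ)) ^ (d + 1 + 1))⁻¹) * ((sf * sm)⁻¹ * (sf⁻¹ * sf⁻¹) * cE))) ^ 2 * (sf * sf) *
            (((if ν = μ ∧ α = β then (1 : ℝ) else 0) - (if ν = β ∧ α = μ then (1 : ℝ) else 0)) * ((1 / 2 : ℝ) * (Lc : ℝ) ^ (d - 1) * ((Lc : ℝ) ^ (d + 1) - (Lc : ℝ) ^ (d - 1))))) := by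
  classical
  have hLc : 1 ≤ Lc := Nat.one_le_iff_ne_zero.mpr (NeZero.ne Lc)
  have hr0 := ctrOff_mem_box (d := d + 1) (pos_Lc (Lc := Lc))
  -- the comb tokens are the bm chart on transported tables
  rw [zmode_combForcing_eq_bm_transport (symTablesAn1S2 d Lc cΛt) sf sm cE cVH cΛ c cB B 0 Lc μ ν (Sum.inl α) (Sum.inl β)]
  -- decay data at one rate
  obtain ⟨CX, δX, hδX, hXd⟩ := spr_unitK_bm (d := d) (Lc := Lc) sf sm 0
  obtain ⟨Cs, δs, hδs, hS⟩ := exists_locStencil_transport_S (symTablesAn1S2 d Lc cΛt) sf sm cE cVH cΛ 0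
  obtain ⟨CM, δM, hδM, hM⟩ := exists_vertexFamily_transport_M (symTablesAn1S2 d Lc cΛt) sf sm 0
  obtain ⟨C₂, δ₂, hδ₂, hM₂⟩ := exists_locStencilFM_transport_M₂ (symTablesAn1S2 d Lc cΛt) sf sm 0
  have hCX : 0 ≤ CX := hXd.nonneg (Sum.inl 0)
  have hCs : 0 ≤ Cs := (hS 0 0).nonneg (Sum.inl 0)
  have hCM : 0 ≤ CM := (hM 0 0).nonneg (Sum.inl 0)
  set m : ℝ := min (min δX δs) δM with hm
  have hm0 : 0 < m := lt_min (lt_min hδX hδs) hδM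
  have hX1 : Decays (unitK sf sm (coDressKBmAt (ctr (d + 1) Lc) Lc (KInvStep (d := d) Lc 0))) CX m := decays_mono hXd hCX le_rfl ((min_le_left _ _).trans (min_le_left _ _))
  have hS1 := BalabanStepJets.locStencil_mono hS hCs ((min_le_left _ _).trans (min_le_right _ _) : m ≤ δs)
  have hM1 : VertexFamily (fun ρ w => comp (comp (trK (psiKS (ctrOff (d + 1) Lc) Lc)) (unitM sf sm ((symTablesAn1S2 d Lc cΛt).M 0) ρ w)) (psiKS (ctrOff (d + 1) Lc) Lc)) Lc CM m :=
    fun ρ' w => biLoc_mono (hM ρ' w) hCM (min_le_right _ _)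
  have hV := vertexFamily_dM (N := Lc) hX1 hCX hS1 hM1 hm0 le_rfl
  have hX : Spr (unitK sf sm (coDressKBmAt (ctr (d + 1) Lc) Lc (KInvStep (d := d) Lc 0))) := ⟨_, _, hm0, hX1⟩
  have hρα : ∀ y : Site (d + 1), |(if y α % (Lc : ℤ) = (Lc : ℤ) - 1 then (1 : ℝ) else 0)| ≤ 1 := fun y => by split_ifs <;> simp
  have hρβ : ∀ w : Site (d + 1), |(if w β % (Lc : ℤ) = (Lc : ℤ) - 1 then (1 : ℝ) else 0)| ≤ 1 := fun w => by split_ifs <;> simp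
  have hb := loc_dM_bm_transport (symTablesAn1S2 d Lc cΛt) sf sm cE cVH cΛ 0
  have hW := loc_W2SymOfK_bm_transport (symTablesAn1S2 d Lc cΛt) sf sm cE cVH cΛ 0
  -- the kernel root spelled `toSite (ctrOff (d+1) Lc)` (`ctr` unfolds to it by `rfl`), so that F5's `K·W·K` letter matches
  simp only [show ctr (d + 1) Lc = toSite (ctrOff (d + 1) Lc) from rfl] at hW
  have h1 := fun u : Site (d + 1) => summable_right_word (Lc := Lc) (hb μ u) hX hV (half_pos hm0) hρα hρβ ν (Sum.inl α) (Sum.inl β)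
  have h2 := fun u : Site (d + 1) => summable_left_word (Lc := Lc) (hb μ u) hX hV (half_pos hm0) hρα hρβ ν (Sum.inl α) (Sum.inl β)
  have h3 := fun u : Site (d + 1) => summable_twoFace_W2SymOfK_dressedStep_bond hLc hr0 sf sm 0 hS hδs hM hδM hM₂ hδ₂
    (fun κ u' ρ w t => transportM₂_translate (symTablesAn1S2 d Lc cΛt) sf sm 0 κ u' ρ w t) hρα hρβ
    (fun y s => face_weight_periodic Lc α y s) (fun w s => face_weight_periodic Lc β w s) μ u ν (Sum.inl α) (Sum.inl β)
  refine (zmode_dressedSource_inl_inl_of_summable hLc hr0 sf sm 0 c cB hb hW hBff Lc μ ν α β h1 h2 h3).trans ?_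
  rw [sum_box_comb_direct_word_level0_eq, sum_box_comb_swap_word_level0_eq, sum_box_tsum_W_word_an1_eq_zero (d := d) (Lc := Lc) cΛt sf sm cE cVH cΛ 0 Lc μ ν α β, sub_zero]

/-! ## §2 `hB0` at level 0 at the comb data -/

/-- NOT IN PRINT; OUR BOOKKEEPING (leaf-06 g55's §1 at the comb tokens).  With `P(a b; c e) := [a=c]·[b=e] − [a=e]·[b=c]`:
`zmode Lc b̃′_0 (κ,κ′; inl κ₁, inl κ₂) = C₀·P(κκ₁;κ′κ₂) + C₀·P(κ′κ₁;κκ₂)`. -/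
theorem zmode_combForcing_level0_eq_pairForm (cΛt sf sm cE cVH cΛ c cB : ℝ) {B : Tab d}
    (hBff : ∀ κ u κ' u' x z (α β : Fin (d + 1)), B κ u κ' u' x z (Sum.inl α) (Sum.inl β) = 0) (κ κ' κ₁ κ₂ : Fin (d + 1)) :
    zmode Lc (fun κ u κ' u' => c • mmRead Lc (K3OfK (unitK sf sm (GcombSh (d := d) Lc 0)) Lc (unitS sf sm (SpureCombOf (symTablesAn1S2 d Lc cΛt) cE cVH cΛ 0))
        (unitM sf sm ((symTablesAn1S2 d Lc cΛt).M 0))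
        (W2SymOfK (unitK sf sm (GcombSh (d := d) Lc 0)) Lc (unitS sf sm (SpureCombOf (symTablesAn1S2 d Lc cΛt) cE cVH cΛ 0)) (unitM sf sm ((symTablesAn1S2 d Lc cΛt).M 0)) 0
          (unitM₂ sf sm (M2Of d Lc (symTablesAn1S2 d Lc cΛt).mixFF 0))) κ u κ' u') + cB • B κ u κ' u') κ κ' (Sum.inl κ₁) (Sum.inl κ₂) =
      (c * (-((sf * sm * ((((Lc ^ (0 + 1) : ℕ) : ℝ)) ^ (d + 1 + 1))⁻¹) * (sf * sm * ((((Lc ^ (0 + 1) : ℕ) : ℝ)) ^ (d + 1 + 1))⁻¹)) * ((Lc : ℝ) * (Lc : ℝ))) *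
        (-(((((Lc : ℝ) * (sm * sf)) * ((((Lc ^ (0 + 1) : ℕ) : ℝ)) ^ (d + 1 + 1))⁻¹) * ((sf * sm)⁻¹ * (sf⁻¹ * sf⁻¹) * cE))) ^ 2 * (sf * sf) *
          ((1 / 2 : ℝ) * (Lc : ℝ) ^ (d - 1) * ((Lc : ℝ) ^ (d + 1) - (Lc : ℝ) ^ (d - 1))))) *
        ((if κ = κ' then (1 : ℝ) else 0) * (if κ₁ = κ₂ then (1 : ℝ) else 0) - (if κ = κ₂ then (1 : ℝ) else 0) * (if κ₁ = κ' then (1 : ℝ) else 0)) +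
      (c * (-((sf * sm * ((((Lc ^ (0 + 1) : ℕ) : ℝ)) ^ (d + 1 + 1))⁻¹) * (sf * sm * ((((Lc ^ (0 + 1) : ℕ) : ℝ)) ^ (d + 1 + 1))⁻¹)) * ((Lc : ℝ) * (Lc : ℝ))) *
        (-(((((Lc : ℝ) * (sm * sf)) * ((((Lc ^ (0 + 1) : ℕ) : ℝ)) ^ (d + 1 + 1))⁻¹) * ((sf * sm)⁻¹ * (sf⁻¹ * sf⁻¹) * cE))) ^ 2 * (sf * sf) *
          ((1 / 2 : ℝ) * (Lc : ℝ) ^ (d - 1) * ((Lc : ℝ) ^ (d + 1) - (Lc : ℝ) ^ (d - 1))))) *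
        ((if κ' = κ then (1 : ℝ) else 0) * (if κ₁ = κ₂ then (1 : ℝ) else 0) - (if κ' = κ₂ then (1 : ℝ) else 0) * (if κ₁ = κ then (1 : ℝ) else 0)) := by
  have hsplit : ∀ (P Q : Prop) [Decidable P] [Decidable Q],
      (if P ∧ Q then (1 : ℝ) else 0) = (if P then (1 : ℝ) else 0) * (if Q then (1 : ℝ) else 0) := by
    intro P Q _ _
    rw [ite_zero_mul_ite_zero, one_mul]
  rw [zmode_combForcing_level0_closed cΛt sf sm cE cVH cΛ c cB hBff κ κ' κ₁ κ₂]
  rw [hsplit, hsplit, hsplit, hsplit]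
  ring

/-- NOT IN PRINT; OUR BOOKKEEPING (leaf-06 g55's §2 at the comb tokens).  **`hB0` AT LEVEL `0` AT THE COMB DATA** (generic `d`; an1's record, every unit pair, all colour constants, scalars
`c cB`, ANY border `B` without ff block): the leg-and-bond symmetrised ff cell zero mode of `b̃′_0` is an antisymmetric-pair form in road-P2 F9's spelling — witness `T = 2·C₀·P`. -/
theorem pairFormLS_combForcing_level0 (cΛt sf sm cE cVH cΛ c cB : ℝ) {B : Tab d}
    (hBff : ∀ κ u κ' u' x z (α β : Fin (d + 1)), B κ u κ' u' x z (Sum.inl α) (Sum.inl β) = 0) :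
    ∃ T : Fin (d + 1) → Fin (d + 1) → Fin (d + 1) → Fin (d + 1) → ℝ,
      (∀ a b c e : Fin (d + 1), T b a c e = -T a b c e) ∧ (∀ a b c e : Fin (d + 1), T a b e c = -T a b c e) ∧
      ∀ κ κ' κ₁ κ₂ : Fin (d + 1),
        (zmode Lc (fun κ u κ' u' => c • mmRead Lc (K3OfK (unitK sf sm (GcombSh (d := d) Lc 0)) Lc (unitS sf sm (SpureCombOf (symTablesAn1S2 d Lc cΛt) cE cVH cΛ 0))
            (unitM sf sm ((symTablesAn1S2 d Lc cΛt).M 0))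
            (W2SymOfK (unitK sf sm (GcombSh (d := d) Lc 0)) Lc (unitS sf sm (SpureCombOf (symTablesAn1S2 d Lc cΛt) cE cVH cΛ 0)) (unitM sf sm ((symTablesAn1S2 d Lc cΛt).M 0)) 0
              (unitM₂ sf sm (M2Of d Lc (symTablesAn1S2 d Lc cΛt).mixFF 0))) κ u κ' u') + cB • B κ u κ' u') κ κ' (Sum.inl κ₁) (Sum.inl κ₂)
        + zmode Lc (fun κ u κ' u' => c • mmRead Lc (K3OfK (unitK sf sm (GcombSh (d := d) Lc 0)) Lc (unitS sf sm (SpureCombOf (symTablesAn1S2 d Lc cΛt) cE cVH cΛ 0))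
            (unitM sf sm ((symTablesAn1S2 d Lc cΛt).M 0))
            (W2SymOfK (unitK sf sm (GcombSh (d := d) Lc 0)) Lc (unitS sf sm (SpureCombOf (symTablesAn1S2 d Lc cΛt) cE cVH cΛ 0)) (unitM sf sm ((symTablesAn1S2 d Lc cΛt).M 0)) 0
              (unitM₂ sf sm (M2Of d Lc (symTablesAn1S2 d Lc cΛt).mixFF 0))) κ u κ' u') + cB • B κ u κ' u') κ' κ (Sum.inl κ₁) (Sum.inl κ₂)
        + (zmode Lc (fun κ u κ' u' => c • mmRead Lc (K3OfK (unitK sf sm (GcombSh (d := d) Lc 0)) Lc (unitS sf sm (SpureCombOf (symTablesAn1S2 d Lc cΛt) cE cVH cΛ 0))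
            (unitM sf sm ((symTablesAn1S2 d Lc cΛt).M 0))
            (W2SymOfK (unitK sf sm (GcombSh (d := d) Lc 0)) Lc (unitS sf sm (SpureCombOf (symTablesAn1S2 d Lc cΛt) cE cVH cΛ 0)) (unitM sf sm ((symTablesAn1S2 d Lc cΛt).M 0)) 0
              (unitM₂ sf sm (M2Of d Lc (symTablesAn1S2 d Lc cΛt).mixFF 0))) κ u κ' u') + cB • B κ u κ' u') κ κ' (Sum.inl κ₂) (Sum.inl κ₁)
        + zmode Lc (fun κ u κ' u' => c • mmRead Lc (K3OfK (unitK sf sm (GcombSh (d := d) Lc 0)) Lc (unitS sf sm (SpureCombOf (symTablesAn1S2 d Lc cΛt) cE cVH cΛ 0))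
            (unitM sf sm ((symTablesAn1S2 d Lc cΛt).M 0))
            (W2SymOfK (unitK sf sm (GcombSh (d := d) Lc 0)) Lc (unitS sf sm (SpureCombOf (symTablesAn1S2 d Lc cΛt) cE cVH cΛ 0)) (unitM sf sm ((symTablesAn1S2 d Lc cΛt).M 0)) 0
              (unitM₂ sf sm (M2Of d Lc (symTablesAn1S2 d Lc cΛt).mixFF 0))) κ u κ' u') + cB • B κ u κ' u') κ' κ (Sum.inl κ₂) (Sum.inl κ₁)))
          = T κ κ₁ κ' κ₂ + T κ' κ₁ κ κ₂ + (T κ κ₂ κ' κ₁ + T κ' κ₂ κ κ₁) := by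
  refine ⟨fun a b c' e =>
      2 * ((c * (-((sf * sm * ((((Lc ^ (0 + 1) : ℕ) : ℝ)) ^ (d + 1 + 1))⁻¹) * (sf * sm * ((((Lc ^ (0 + 1) : ℕ) : ℝ)) ^ (d + 1 + 1))⁻¹)) * ((Lc : ℝ) * (Lc : ℝ))) *
        (-(((((Lc : ℝ) * (sm * sf)) * ((((Lc ^ (0 + 1) : ℕ) : ℝ)) ^ (d + 1 + 1))⁻¹) * ((sf * sm)⁻¹ * (sf⁻¹ * sf⁻¹) * cE))) ^ 2 * (sf * sf) *
          ((1 / 2 : ℝ) * (Lc : ℝ) ^ (d - 1) * ((Lc : ℝ) ^ (d + 1) - (Lc : ℝ) ^ (d - 1))))) *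
        ((if a = c' then (1 : ℝ) else 0) * (if b = e then (1 : ℝ) else 0) - (if a = e then (1 : ℝ) else 0) * (if b = c' then (1 : ℝ) else 0))),
    fun a b c' e => by ring, fun a b c' e => by ring, fun κ κ' κ₁ κ₂ => ?_⟩
  exact pairFormLS_of_pairForm
    (A := fun κ κ' κ₁ κ₂ => zmode Lc (fun κ u κ' u' => c • mmRead Lc (K3OfK (unitK sf sm (GcombSh (d := d) Lc 0)) Lc (unitS sf sm (SpureCombOf (symTablesAn1S2 d Lc cΛt) cE cVH cΛ 0))
            (unitM sf sm ((symTablesAn1S2 d Lc cΛt).M 0))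
            (W2SymOfK (unitK sf sm (GcombSh (d := d) Lc 0)) Lc (unitS sf sm (SpureCombOf (symTablesAn1S2 d Lc cΛt) cE cVH cΛ 0)) (unitM sf sm ((symTablesAn1S2 d Lc cΛt).M 0)) 0
              (unitM₂ sf sm (M2Of d Lc (symTablesAn1S2 d Lc cΛt).mixFF 0))) κ u κ' u') + cB • B κ u κ' u') κ κ' (Sum.inl κ₁) (Sum.inl κ₂))
    (P := fun a b c' e =>
      (c * (-((sf * sm * ((((Lc ^ (0 + 1) : ℕ) : ℝ)) ^ (d + 1 + 1))⁻¹) * (sf * sm * ((((Lc ^ (0 + 1) : ℕ) : ℝ)) ^ (d + 1 + 1))⁻¹)) * ((Lc : ℝ) * (Lc : ℝ))) *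
        (-(((((Lc : ℝ) * (sm * sf)) * ((((Lc ^ (0 + 1) : ℕ) : ℝ)) ^ (d + 1 + 1))⁻¹) * ((sf * sm)⁻¹ * (sf⁻¹ * sf⁻¹) * cE))) ^ 2 * (sf * sf) *
          ((1 / 2 : ℝ) * (Lc : ℝ) ^ (d - 1) * ((Lc : ℝ) ^ (d + 1) - (Lc : ℝ) ^ (d - 1))))) *
        ((if a = c' then (1 : ℝ) else 0) * (if b = e then (1 : ℝ) else 0) - (if a = e then (1 : ℝ) else 0) * (if b = c' then (1 : ℝ) else 0)))
    (fun κ κ' κ₁ κ₂ => zmode_combForcing_level0_eq_pairForm cΛt sf sm cE cVH cΛ c cB hBff κ κ' κ₁ κ₂) κ κ' κ₁ κ₂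

/-- NOT IN PRINT; OUR BOOKKEEPING (leaf-06 g55's §3 at the comb tokens).  **THE OWNER's `hB0` AT `i = 0`, LITERAL** (`d = 3`; units `sfStep Lc 0`, `smStep 3 Lc 0`; scale `cE₂ * Lc^(2*(3+1))`;
an1's sym record `symTablesAn1S2 3 Lc cΛt` and its border `vh₂S` — no ff block, `rfl`; all colour constants): the body of `CombChartChargeTowerPairFormClosed`'s binder `hB0` with `i := 0`. -/
theorem pairFormLS_combForcing_level0_lit (cΛt cE cVH cΛ cE₂ cB : ℝ) :
    ∃ T : Fin (3 + 1) → Fin (3 + 1) → Fin (3 + 1) → Fin (3 + 1) → ℝ,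
      (∀ a b c e : Fin (3 + 1), T b a c e = -T a b c e) ∧ (∀ a b c e : Fin (3 + 1), T a b e c = -T a b c e) ∧
      ∀ κ κ' κ₁ κ₂ : Fin (3 + 1),
        (zmode Lc (fun κ u κ' u' => (cE₂ * (Lc : ℝ) ^ (2 * (3 + 1))) • mmRead Lc (K3OfK (unitK (sfStep Lc 0) (smStep 3 Lc 0) (GcombSh (d := 3) Lc 0)) Lc
            (unitS (sfStep Lc 0) (smStep 3 Lc 0) (SpureCombOf (symTablesAn1S2 3 Lc cΛt) cE cVH cΛ 0)) (unitM (sfStep Lc 0) (smStep 3 Lc 0) ((symTablesAn1S2 3 Lc cΛt).M 0))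
            (W2SymOfK (unitK (sfStep Lc 0) (smStep 3 Lc 0) (GcombSh (d := 3) Lc 0)) Lc (unitS (sfStep Lc 0) (smStep 3 Lc 0) (SpureCombOf (symTablesAn1S2 3 Lc cΛt) cE cVH cΛ 0))
              (unitM (sfStep Lc 0) (smStep 3 Lc 0) ((symTablesAn1S2 3 Lc cΛt).M 0)) 0 (unitM₂ (sfStep Lc 0) (smStep 3 Lc 0) (M2Of 3 Lc (symTablesAn1S2 3 Lc cΛt).mixFF 0))) κ u κ' u')
            + cB • (symTablesAn1S2 3 Lc cΛt).vh₂S κ u κ' u') κ κ' (Sum.inl κ₁) (Sum.inl κ₂)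
        + zmode Lc (fun κ u κ' u' => (cE₂ * (Lc : ℝ) ^ (2 * (3 + 1))) • mmRead Lc (K3OfK (unitK (sfStep Lc 0) (smStep 3 Lc 0) (GcombSh (d := 3) Lc 0)) Lc
            (unitS (sfStep Lc 0) (smStep 3 Lc 0) (SpureCombOf (symTablesAn1S2 3 Lc cΛt) cE cVH cΛ 0)) (unitM (sfStep Lc 0) (smStep 3 Lc 0) ((symTablesAn1S2 3 Lc cΛt).M 0))
            (W2SymOfK (unitK (sfStep Lc 0) (smStep 3 Lc 0) (GcombSh (d := 3) Lc 0)) Lc (unitS (sfStep Lc 0) (smStep 3 Lc 0) (SpureCombOf (symTablesAn1S2 3 Lc cΛt) cE cVH cΛ 0))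
              (unitM (sfStep Lc 0) (smStep 3 Lc 0) ((symTablesAn1S2 3 Lc cΛt).M 0)) 0 (unitM₂ (sfStep Lc 0) (smStep 3 Lc 0) (M2Of 3 Lc (symTablesAn1S2 3 Lc cΛt).mixFF 0))) κ u κ' u')
            + cB • (symTablesAn1S2 3 Lc cΛt).vh₂S κ u κ' u') κ' κ (Sum.inl κ₁) (Sum.inl κ₂)
        + (zmode Lc (fun κ u κ' u' => (cE₂ * (Lc : ℝ) ^ (2 * (3 + 1))) • mmRead Lc (K3OfK (unitK (sfStep Lc 0) (smStep 3 Lc 0) (GcombSh (d := 3) Lc 0)) Lc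
            (unitS (sfStep Lc 0) (smStep 3 Lc 0) (SpureCombOf (symTablesAn1S2 3 Lc cΛt) cE cVH cΛ 0)) (unitM (sfStep Lc 0) (smStep 3 Lc 0) ((symTablesAn1S2 3 Lc cΛt).M 0))
            (W2SymOfK (unitK (sfStep Lc 0) (smStep 3 Lc 0) (GcombSh (d := 3) Lc 0)) Lc (unitS (sfStep Lc 0) (smStep 3 Lc 0) (SpureCombOf (symTablesAn1S2 3 Lc cΛt) cE cVH cΛ 0))
              (unitM (sfStep Lc 0) (smStep 3 Lc 0) ((symTablesAn1S2 3 Lc cΛt).M 0)) 0 (unitM₂ (sfStep Lc 0) (smStep 3 Lc 0) (M2Of 3 Lc (symTablesAn1S2 3 Lc cΛt).mixFF 0))) κ u κ' u')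
            + cB • (symTablesAn1S2 3 Lc cΛt).vh₂S κ u κ' u') κ κ' (Sum.inl κ₂) (Sum.inl κ₁)
        + zmode Lc (fun κ u κ' u' => (cE₂ * (Lc : ℝ) ^ (2 * (3 + 1))) • mmRead Lc (K3OfK (unitK (sfStep Lc 0) (smStep 3 Lc 0) (GcombSh (d := 3) Lc 0)) Lc
            (unitS (sfStep Lc 0) (smStep 3 Lc 0) (SpureCombOf (symTablesAn1S2 3 Lc cΛt) cE cVH cΛ 0)) (unitM (sfStep Lc 0) (smStep 3 Lc 0) ((symTablesAn1S2 3 Lc cΛt).M 0))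
            (W2SymOfK (unitK (sfStep Lc 0) (smStep 3 Lc 0) (GcombSh (d := 3) Lc 0)) Lc (unitS (sfStep Lc 0) (smStep 3 Lc 0) (SpureCombOf (symTablesAn1S2 3 Lc cΛt) cE cVH cΛ 0))
              (unitM (sfStep Lc 0) (smStep 3 Lc 0) ((symTablesAn1S2 3 Lc cΛt).M 0)) 0 (unitM₂ (sfStep Lc 0) (smStep 3 Lc 0) (M2Of 3 Lc (symTablesAn1S2 3 Lc cΛt).mixFF 0))) κ u κ' u')
            + cB • (symTablesAn1S2 3 Lc cΛt).vh₂S κ u κ' u') κ' κ (Sum.inl κ₂) (Sum.inl κ₁)))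
          = T κ κ₁ κ' κ₂ + T κ' κ₁ κ κ₂ + (T κ κ₂ κ' κ₁ + T κ' κ₂ κ κ₁) :=
  pairFormLS_combForcing_level0 (d := 3) cΛt (sfStep Lc 0) (smStep 3 Lc 0) cE cVH cΛ (cE₂ * (Lc : ℝ) ^ (2 * (3 + 1))) cB (fun _ _ _ _ _ _ _ _ => rfl)

/-! ## §3 The crossed cell VALUE at level 0 at the comb data (the OWNER's question (β)) -/

/-- NOT IN PRINT; OUR BOOKKEEPING (leaf-06 g55's §4 at the comb tokens).  For `a ≠ b`: `X(zmode_Lc b̃′_0)(a,b) := Z abab + Z baab + (Z abba + Z baba) = −4·C₀`. -/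
theorem crossed_zmode_combForcing_level0 (cΛt sf sm cE cVH cΛ c cB : ℝ) {B : Tab d}
    (hBff : ∀ κ u κ' u' x z (α β : Fin (d + 1)), B κ u κ' u' x z (Sum.inl α) (Sum.inl β) = 0) {a b : Fin (d + 1)} (hab : a ≠ b) :
    zmode Lc (fun κ u κ' u' => c • mmRead Lc (K3OfK (unitK sf sm (GcombSh (d := d) Lc 0)) Lc (unitS sf sm (SpureCombOf (symTablesAn1S2 d Lc cΛt) cE cVH cΛ 0))
            (unitM sf sm ((symTablesAn1S2 d Lc cΛt).M 0))
            (W2SymOfK (unitK sf sm (GcombSh (d := d) Lc 0)) Lc (unitS sf sm (SpureCombOf (symTablesAn1S2 d Lc cΛt) cE cVH cΛ 0)) (unitM sf sm ((symTablesAn1S2 d Lc cΛt).M 0)) 0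
              (unitM₂ sf sm (M2Of d Lc (symTablesAn1S2 d Lc cΛt).mixFF 0))) κ u κ' u') + cB • B κ u κ' u') a b (Sum.inl a) (Sum.inl b)
      + zmode Lc (fun κ u κ' u' => c • mmRead Lc (K3OfK (unitK sf sm (GcombSh (d := d) Lc 0)) Lc (unitS sf sm (SpureCombOf (symTablesAn1S2 d Lc cΛt) cE cVH cΛ 0))
            (unitM sf sm ((symTablesAn1S2 d Lc cΛt).M 0))
            (W2SymOfK (unitK sf sm (GcombSh (d := d) Lc 0)) Lc (unitS sf sm (SpureCombOf (symTablesAn1S2 d Lc cΛt) cE cVH cΛ 0)) (unitM sf sm ((symTablesAn1S2 d Lc cΛt).M 0)) 0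
              (unitM₂ sf sm (M2Of d Lc (symTablesAn1S2 d Lc cΛt).mixFF 0))) κ u κ' u') + cB • B κ u κ' u') b a (Sum.inl a) (Sum.inl b)
      + (zmode Lc (fun κ u κ' u' => c • mmRead Lc (K3OfK (unitK sf sm (GcombSh (d := d) Lc 0)) Lc (unitS sf sm (SpureCombOf (symTablesAn1S2 d Lc cΛt) cE cVH cΛ 0))
            (unitM sf sm ((symTablesAn1S2 d Lc cΛt).M 0))
            (W2SymOfK (unitK sf sm (GcombSh (d := d) Lc 0)) Lc (unitS sf sm (SpureCombOf (symTablesAn1S2 d Lc cΛt) cE cVH cΛ 0)) (unitM sf sm ((symTablesAn1S2 d Lc cΛt).M 0)) 0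
              (unitM₂ sf sm (M2Of d Lc (symTablesAn1S2 d Lc cΛt).mixFF 0))) κ u κ' u') + cB • B κ u κ' u') a b (Sum.inl b) (Sum.inl a)
      + zmode Lc (fun κ u κ' u' => c • mmRead Lc (K3OfK (unitK sf sm (GcombSh (d := d) Lc 0)) Lc (unitS sf sm (SpureCombOf (symTablesAn1S2 d Lc cΛt) cE cVH cΛ 0))
            (unitM sf sm ((symTablesAn1S2 d Lc cΛt).M 0))
            (W2SymOfK (unitK sf sm (GcombSh (d := d) Lc 0)) Lc (unitS sf sm (SpureCombOf (symTablesAn1S2 d Lc cΛt) cE cVH cΛ 0)) (unitM sf sm ((symTablesAn1S2 d Lc cΛt).M 0)) 0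
              (unitM₂ sf sm (M2Of d Lc (symTablesAn1S2 d Lc cΛt).mixFF 0))) κ u κ' u') + cB • B κ u κ' u') b a (Sum.inl b) (Sum.inl a))
      = -4 * (c * (-((sf * sm * ((((Lc ^ (0 + 1) : ℕ) : ℝ)) ^ (d + 1 + 1))⁻¹) * (sf * sm * ((((Lc ^ (0 + 1) : ℕ) : ℝ)) ^ (d + 1 + 1))⁻¹)) * ((Lc : ℝ) * (Lc : ℝ))) *
        (-(((((Lc : ℝ) * (sm * sf)) * ((((Lc ^ (0 + 1) : ℕ) : ℝ)) ^ (d + 1 + 1))⁻¹) * ((sf * sm)⁻¹ * (sf⁻¹ * sf⁻¹) * cE))) ^ 2 * (sf * sf) *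
          ((1 / 2 : ℝ) * (Lc : ℝ) ^ (d - 1) * ((Lc : ℝ) ^ (d + 1) - (Lc : ℝ) ^ (d - 1))))) := by
  have hba : b ≠ a := fun h => hab h.symm
  rw [zmode_combForcing_level0_eq_pairForm cΛt sf sm cE cVH cΛ c cB hBff, zmode_combForcing_level0_eq_pairForm cΛt sf sm cE cVH cΛ c cB hBff,
    zmode_combForcing_level0_eq_pairForm cΛt sf sm cE cVH cΛ c cB hBff, zmode_combForcing_level0_eq_pairForm cΛt sf sm cE cVH cΛ c cB hBff]
  rw [if_neg hab, if_neg hba, if_pos (rfl : a = a), if_pos (rfl : b = b)]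
  ring

/-- NOT IN PRINT; OUR BOOKKEEPING (leaf-06 g55's pin at the comb tokens; the OWNER's (β)).  **`X(zmode_Lc b̃′_0)(a,b) = −2·Lc¹²·(Lc² − 1)`** (`d = 3`; units `sfStep Lc 0`, `smStep 3 Lc 0`;
scale `cE₂ * Lc^(2*(3+1))`; an1's sym record and its border `vh₂S`; the END probe's pins `cE = Lc^(3+1)`, `cE₂ = Lc^(2*(3+1))`; `cVH cΛ cΛt cB` free; `a ≠ b`). -/
theorem crossed_zmode_combForcing_level0_pin {cE cE₂ : ℝ} (cΛt cVH cΛ cB : ℝ) (hcE : cE = (Lc : ℝ) ^ (3 + 1)) (hcE₂ : cE₂ = (Lc : ℝ) ^ (2 * (3 + 1)))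
    {a b : Fin (3 + 1)} (hab : a ≠ b) :
    zmode Lc (fun κ u κ' u' => (cE₂ * (Lc : ℝ) ^ (2 * (3 + 1))) • mmRead Lc (K3OfK (unitK (sfStep Lc 0) (smStep 3 Lc 0) (GcombSh (d := 3) Lc 0)) Lc
            (unitS (sfStep Lc 0) (smStep 3 Lc 0) (SpureCombOf (symTablesAn1S2 3 Lc cΛt) cE cVH cΛ 0)) (unitM (sfStep Lc 0) (smStep 3 Lc 0) ((symTablesAn1S2 3 Lc cΛt).M 0))
            (W2SymOfK (unitK (sfStep Lc 0) (smStep 3 Lc 0) (GcombSh (d := 3) Lc 0)) Lc (unitS (sfStep Lc 0) (smStep 3 Lc 0) (SpureCombOf (symTablesAn1S2 3 Lc cΛt) cE cVH cΛ 0))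
              (unitM (sfStep Lc 0) (smStep 3 Lc 0) ((symTablesAn1S2 3 Lc cΛt).M 0)) 0 (unitM₂ (sfStep Lc 0) (smStep 3 Lc 0) (M2Of 3 Lc (symTablesAn1S2 3 Lc cΛt).mixFF 0))) κ u κ' u')
            + cB • (symTablesAn1S2 3 Lc cΛt).vh₂S κ u κ' u') a b (Sum.inl a) (Sum.inl b)
      + zmode Lc (fun κ u κ' u' => (cE₂ * (Lc : ℝ) ^ (2 * (3 + 1))) • mmRead Lc (K3OfK (unitK (sfStep Lc 0) (smStep 3 Lc 0) (GcombSh (d := 3) Lc 0)) Lc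
            (unitS (sfStep Lc 0) (smStep 3 Lc 0) (SpureCombOf (symTablesAn1S2 3 Lc cΛt) cE cVH cΛ 0)) (unitM (sfStep Lc 0) (smStep 3 Lc 0) ((symTablesAn1S2 3 Lc cΛt).M 0))
            (W2SymOfK (unitK (sfStep Lc 0) (smStep 3 Lc 0) (GcombSh (d := 3) Lc 0)) Lc (unitS (sfStep Lc 0) (smStep 3 Lc 0) (SpureCombOf (symTablesAn1S2 3 Lc cΛt) cE cVH cΛ 0))
              (unitM (sfStep Lc 0) (smStep 3 Lc 0) ((symTablesAn1S2 3 Lc cΛt).M 0)) 0 (unitM₂ (sfStep Lc 0) (smStep 3 Lc 0) (M2Of 3 Lc (symTablesAn1S2 3 Lc cΛt).mixFF 0))) κ u κ' u')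
            + cB • (symTablesAn1S2 3 Lc cΛt).vh₂S κ u κ' u') b a (Sum.inl a) (Sum.inl b)
      + (zmode Lc (fun κ u κ' u' => (cE₂ * (Lc : ℝ) ^ (2 * (3 + 1))) • mmRead Lc (K3OfK (unitK (sfStep Lc 0) (smStep 3 Lc 0) (GcombSh (d := 3) Lc 0)) Lc
            (unitS (sfStep Lc 0) (smStep 3 Lc 0) (SpureCombOf (symTablesAn1S2 3 Lc cΛt) cE cVH cΛ 0)) (unitM (sfStep Lc 0) (smStep 3 Lc 0) ((symTablesAn1S2 3 Lc cΛt).M 0))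
            (W2SymOfK (unitK (sfStep Lc 0) (smStep 3 Lc 0) (GcombSh (d := 3) Lc 0)) Lc (unitS (sfStep Lc 0) (smStep 3 Lc 0) (SpureCombOf (symTablesAn1S2 3 Lc cΛt) cE cVH cΛ 0))
              (unitM (sfStep Lc 0) (smStep 3 Lc 0) ((symTablesAn1S2 3 Lc cΛt).M 0)) 0 (unitM₂ (sfStep Lc 0) (smStep 3 Lc 0) (M2Of 3 Lc (symTablesAn1S2 3 Lc cΛt).mixFF 0))) κ u κ' u')
            + cB • (symTablesAn1S2 3 Lc cΛt).vh₂S κ u κ' u') a b (Sum.inl b) (Sum.inl a)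
      + zmode Lc (fun κ u κ' u' => (cE₂ * (Lc : ℝ) ^ (2 * (3 + 1))) • mmRead Lc (K3OfK (unitK (sfStep Lc 0) (smStep 3 Lc 0) (GcombSh (d := 3) Lc 0)) Lc
            (unitS (sfStep Lc 0) (smStep 3 Lc 0) (SpureCombOf (symTablesAn1S2 3 Lc cΛt) cE cVH cΛ 0)) (unitM (sfStep Lc 0) (smStep 3 Lc 0) ((symTablesAn1S2 3 Lc cΛt).M 0))
            (W2SymOfK (unitK (sfStep Lc 0) (smStep 3 Lc 0) (GcombSh (d := 3) Lc 0)) Lc (unitS (sfStep Lc 0) (smStep 3 Lc 0) (SpureCombOf (symTablesAn1S2 3 Lc cΛt) cE cVH cΛ 0))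
              (unitM (sfStep Lc 0) (smStep 3 Lc 0) ((symTablesAn1S2 3 Lc cΛt).M 0)) 0 (unitM₂ (sfStep Lc 0) (smStep 3 Lc 0) (M2Of 3 Lc (symTablesAn1S2 3 Lc cΛt).mixFF 0))) κ u κ' u')
            + cB • (symTablesAn1S2 3 Lc cΛt).vh₂S κ u κ' u') b a (Sum.inl b) (Sum.inl a))
      = -2 * (Lc : ℝ) ^ 12 * ((Lc : ℝ) ^ 2 - 1) := by
  have hL : (Lc : ℝ) ≠ 0 := Nat.cast_ne_zero.mpr (NeZero.ne Lc)
  rw [crossed_zmode_combForcing_level0 (d := 3) cΛt (sfStep Lc 0) (smStep 3 Lc 0) cE cVH cΛ (cE₂ * (Lc : ℝ) ^ (2 * (3 + 1))) cB (fun _ _ _ _ _ _ _ _ => rfl) hab]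
  subst hcE hcE₂
  simp only [sfStep, smStep, pow_zero, zero_mul, Nat.cast_pow]
  field_simp
  ring

end Summit.QuantumFields.BalabanUV.Beta.GAN24.CombForcingPairFormLevelZero

end
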